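import Summits.BirchSwinnertonDyer.Rank1Residual.Additive.KatoDescentGlobalKummerSelmer
import Literature.NumberTheory.EllipticCurves.Kato2004.IntegralH1FiniteProofs
import Literature.NumberTheory.EllipticCurves.SelmerFiniteProofs
import HarnessLib

set_option autoImplicit false

/-!
# The `T_p`-adic Kummer class of a rational point is UNRAMIFIED AT EVERY GOOD PRIME `ℓ ≠ p`:
# `κ_∞(P)|_{I_𝔓} = 0` in `H¹(⊤ ⊓ I_𝔓, T_pW)` for `𝔓 ∣ ℓ`, `ℓ ∤ pN` — so `κ_∞(P) ∈ H¹(ℤ[1/p], T_pW)`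
# (`Kato2004.integralH1`) as soon as its restrictions to inertia at the BAD primes `ℓ ≠ p` vanish
# (seat `bsd-cm-prr-ty1` g9, cell `bsd-cm`; theorems only: no definition, no named fact, no instance, no `sorry`)

Part 14 of the seat's kernel cut of stub 3 `stub_rankOneCountReadingKato` of the Kato–Perrin-Riou skeletons v4 (cruxes
stmt-BirchSwinnertonDyer-19945 / -19223; = cell bsd-potss's held input 27322). Parts 12–13 built the `T_p`-adic Kummer
class `κ_∞(P) ∈ H¹(⊤, T_pW)` of `P ∈ W(ℚ)` (levels `κ_{p^k}(P)`, `HasLocPKummerLog (log_ω P)`, membership in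
`H¹_f(ℚ, T_pW) = Kato2004.finiteH1`). The display COUNT-EC⁰ measures the module `A = H¹(ℤ[1/p], T_pW)`
(`Kato2004.integralH1 … p ⊤`: classes whose restriction to `⊤ ⊓ I_𝔓` vanishes for every `𝔓` over every `ℓ ≠ p`).
THIS FILE proves the GOOD-PRIME half of «`κ_∞(P) ∈ A` up to Tamagawa torsion»:

* §1 (any field `K`, any `n`, any prime `𝔓` of `ℤ̄_K`) `resLe_inf_inertia_resSubgroup_top_eq_zero_of_mem_unramifiedKer` — plumbing: a
  class of `H¹(K, W[n])` unramified at `𝔓` (`unramifiedKer`, i.e. dying in `H¹(I_𝔓, W[n])`), restricted to `⊤` and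
  then to `⊤ ⊓ I_𝔓`, is `0` (same principal cocycle).
* §2 (`K = ℚ`) **`resLe_inf_inertia_eq_zero_of_forall_eq`** — for `x` with `ofTop(red_{p^k} x) = κ_{p^k}(P)` for all
  `k`, a GOOD place `v ∉ W.badPlaces` with residue characteristic `≠ p`, and `𝔓 ∈ v.primesAbove`:
  `res_{⊤ ⊓ I_𝔓} x = 0` in `H¹(⊤ ⊓ I_𝔓, T_pW)`. Proof: by the separatedness of `H¹(⊤ ⊓ I_𝔓, T_pW) → lim_k H¹(·, W[p^k])`
  (`eq_zero_of_forall_reduceH1Pk_eq_zero`) it suffices that `red_{p^k}(res x) = res(κ_{p^k}(P)|_⊤)` vanish; the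
  level-`p^k` Kummer class lies in the Selmer local condition at `v` (`kummerMapTorsion_mem_selmerLocalKer`), which
  at a good place `v ∤ p^k` is contained in the unramified classes (the tree's `selmerLocalKer_le_unramifiedKer`,
  AEC VII.4.1 / X.4.1 with the inertia facts `exists_mem_inertia_apply_eq_holds`, `smul_localPoints_eq_of_mem_inertia_holds`
  DISCHARGED in the tree), and §1.
* §3 `mem_integralH1_of_forall_eq_of_forall_badPlaces` — hence `x ∈ Kato2004.integralH1 (tateRep W p) p ⊤` as soon as
  `res_{⊤ ⊓ I_𝔓} x = 0` at the primes `𝔓` over the BAD places `v` of residue characteristic `≠ p` (the remaining,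
  Tamagawa-number half: at bad `ℓ ≠ p` only a multiple `c · κ_∞(P)` is unramified, `c` the exponent of the
  geometric component group — not proved here); `mem_integralH1_of_forall_eq_of_badPlaces_subset` — in particular
  `κ_∞(P) ∈ A` outright when every bad place has residue characteristic `p` (e.g. conductor a power of `p`).

HONEST LABEL: theorems only; no stub or item is closed; nothing is registered; nothing is asserted on 19945 / 19223;
Kato's Main Conjecture and Perrin-Riou's conjecture are not touched; BSD is not proved for any curve.

References: [Kato2004Asterisque] §8.2 (pp. 180–181), Lemma 8.5 (pp. 183–184), §14.1 (p. 235); [SilvermanAEC2009]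
VII.4.1, VIII.§2, X.4.1–4.2; [Rubin2000] App. B Prop. B.2.3; [SerreGaloisCohomology1997] I §2.4; [BlochKato1990] Ex. 3.11.
-/

noncomputable section

open scoped Classical NumberField ContRepresentation

open WeierstrassCurve Field IsDedekindDomain NumberField CategoryTheory Literature.NumberTheory.EllipticCurves
  Literature.NumberTheory.EllipticCurves.Kato2004 Literature.NumberTheory.GaloisRepresentations
  Literature.NumberTheory.EllipticCurves.Kato2004.EulerSystemValues
open WeierstrassCurve (geomPoints geomTorsion galH1Torsion selmerLocalKer)

universe u

namespace Summit.BirchSwinnertonDyer.Rank1Residual.Additive.GlobalKummer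

/-! ## §1 Plumbing: unramified classes die on `⊤ ⊓ I_𝔓` -/

section Plumbing

variable {K : Type u} [Field K] (W : WeierstrassCurve K)

/-- **An unramified class dies on `⊤ ⊓ I_𝔓`**: if `c ∈ H¹(K, W[n])` restricts to `0` on the inertia group `I_𝔓`
(`unramifiedKer`), then its restriction to `⊤` followed by the restriction to `⊤ ⊓ I_𝔓 ≤ ⊤` is `0` — the cocycle is
principal on `I_𝔓`, hence on `⊤ ⊓ I_𝔓`. [cite: SerreGaloisCohomology1997, I §2.4] [cite: SilvermanAEC2009, VIII.§2 (p. 191)] -/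
theorem resLe_inf_inertia_resSubgroup_top_eq_zero_of_mem_unramifiedKer (n : ℤ)
    (𝔓 : Ideal (absIntegers (𝓞 K) K)) (c : galH1Torsion W n) (hc : c ∈ unramifiedKer (geomTorsion W n) 𝔓) :
    resLe (W.torsionGaloisModule n).toTopRep
        (inf_le_left : (⊤ : Subgroup (absoluteGaloisGroup K)) ⊓ 𝔓.inertia (absoluteGaloisGroup K) ≤ ⊤) 1
      (resSubgroup (W.torsionGaloisModule n).toTopRep ⊤ 1 c) = 0 := by
  obtain ⟨φ, rfl⟩ := oneCocycleClass_surjective (discreteTopRep (absoluteGaloisGroup K) (geomTorsion W n)) c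
  have hc' := hc
  unfold unramifiedKer subgroupResKer at hc'
  rw [oneCocycleClass_mem_resKer_iff] at hc'
  obtain ⟨a, ha⟩ := hc'
  have h1 : resSubgroup (W.torsionGaloisModule n).toTopRep ⊤ 1
      (oneCocycleClass (discreteTopRep (absoluteGaloisGroup K) (geomTorsion W n)) φ) =
        oneCocycleClass (subgroupRep (W.torsionGaloisModule n).toTopRep ⊤)
          (contOneCocycles.pullback (subgroupSubtypeHom ⊤) (X := (W.torsionGaloisModule n).toTopRep)
            (Y := subgroupRep (W.torsionGaloisModule n).toTopRep ⊤)
            (TopRep.ofHom ⟨ContinuousLinearMap.id ℤ _, fun _ => rfl⟩) φ) :=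
    map_oneCocycleClass _ _ _ _
  rw [h1, resLe_oneCocycleClass, oneCocycleClass_eq_zero_iff]
  refine ⟨a, fun g ↦ ?_⟩
  exact ha ⟨(g : absoluteGaloisGroup K), (Subgroup.mem_inf.mp g.2).2⟩

end Plumbing

/-! ## §2 `κ_∞(P)` is unramified at the good primes `ℓ ≠ p` -/

section Good

variable (W : WeierstrassCurve ℚ) [W.IsElliptic] (p : ℕ) [Fact p.Prime] [ContinuousSMul ℤ_[p] (W.tateModule p)]

omit [W.IsElliptic] [ContinuousSMul ℤ_[p] (W.tateModule p)] in
/-- `p^k ∉ v` for a finite place `v` of `ℚ` of residue characteristic `≠ p` (`v` is prime).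
[cite: NeukirchANT1999, Ch. I §3 (prime ideals of `ℤ`)] -/
theorem intCast_pow_not_mem_asIdeal {v : HeightOneSpectrum (𝓞 ℚ)}
    (hvp : ((Rat.HeightOneSpectrum.primesEquiv v : Nat.Primes) : ℕ) ≠ p) (k : ℕ) :
    (((p : ℤ) ^ k : ℤ) : 𝓞 ℚ) ∉ v.asIdeal := by
  rw [Int.cast_pow, Int.cast_natCast]
  exact fun h ↦ WeierstrassCurve.natCast_not_mem_asIdeal_of_primesEquiv_ne (Fact.out : p.Prime) hvp
    (v.isPrime.mem_of_pow_mem k h)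

/-- **`κ_∞(P)` IS UNRAMIFIED AT EVERY GOOD PRIME `ℓ ≠ p`**: for `x ∈ H¹(⊤, T_pW)` with `ofTop(red_{p^k} x) = κ_{p^k}(P)`
for all `k`, a place `v ∉ W.badPlaces` of residue characteristic `≠ p` and a prime `𝔓` of `ℤ̄` above `v`:
`res_{⊤ ⊓ I_𝔓} x = 0`. (Separatedness of `H¹(⊤ ⊓ I_𝔓, T_pW)` in the tower + the level-`p^k` Kummer classes are
Selmer at `v`, and Selmer = unramified at good `v ∤ p^k`.) [cite: Kato2004Asterisque, §8.2 (p. 181) and §14.1 (p. 235)]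
[cite: SilvermanAEC2009, VII.4.1 and X.4.1] [cite: Rubin2000, App. B Prop. B.2.3] -/
theorem resLe_inf_inertia_eq_zero_of_forall_eq
    (hdiv : ∀ (k : ℕ) (P : geomPoints W), ∃ Q : geomPoints W, ((p : ℤ) ^ k) • Q = P) {P : W.toAffine.Point}
    {x : H1 (tateRep W p) ⊤}
    (hx : ∀ k : ℕ,
      (ofTopSubgroup (W.torsionGaloisModule ((p : ℤ) ^ k)).toTopRep 1).hom (reduceH1Pk W p k ⊤ x) =
        kummerMapTorsion W ((p : ℤ) ^ k) (hdiv k) P)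
    {v : HeightOneSpectrum (𝓞 ℚ)} (hv : v ∉ W.badPlaces (𝓞 ℚ))
    (hvp : ((Rat.HeightOneSpectrum.primesEquiv v : Nat.Primes) : ℕ) ≠ p)
    {𝔓 : Ideal (absIntegers (𝓞 ℚ) ℚ)} (h𝔓 : 𝔓 ∈ v.primesAbove) :
    resLe (tateRep W p).toTopRep
      (inf_le_left : (⊤ : Subgroup (absoluteGaloisGroup ℚ)) ⊓ 𝔓.inertia (absoluteGaloisGroup ℚ) ≤ ⊤) 1 x = 0 := by
  refine eq_zero_of_forall_reduceH1Pk_eq_zero W p _ _ fun k ↦ ?_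
  rw [reduceH1Pk_resLe, reduceH1Pk_eq_resSubgroup_of_ofTopSubgroup_eq W p hdiv hx k]
  exact resLe_inf_inertia_resSubgroup_top_eq_zero_of_mem_unramifiedKer W ((p : ℤ) ^ k) 𝔓 _
    (selmerLocalKer_le_unramifiedKer (IsDedekindDomain.HeightOneSpectrum.exists_mem_inertia_apply_eq_holds v)
      W.smul_localPoints_eq_of_mem_inertia_holds hv (intCast_pow_not_mem_asIdeal p hvp k) h𝔓
      (kummerMapTorsion_mem_selmerLocalKer W ((p : ℤ) ^ k) (hdiv k) (v.adicCompletion ℚ) P))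

/-! ## §3 Integrality away from `p` reduces to the bad primes -/

/-- **`κ_∞(P) ∈ H¹(ℤ[1/p], T_pW)` reduces to the bad primes**: if, at every prime `𝔓` of `ℤ̄` over a BAD place `v` of
residue characteristic `≠ p`, the restriction `res_{⊤ ⊓ I_𝔓} x` vanishes, then `x ∈ Kato2004.integralH1 (tateRep W p) p ⊤`
(the good places are §2). [cite: Kato2004Asterisque, §8.2 (pp. 180–181) and Lemma 8.5 (pp. 183–184)]
[cite: SilvermanAEC2009, VII.4.1] -/
theorem mem_integralH1_of_forall_eq_of_forall_badPlaces
    (hdiv : ∀ (k : ℕ) (P : geomPoints W), ∃ Q : geomPoints W, ((p : ℤ) ^ k) • Q = P) {P : W.toAffine.Point}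
    {x : H1 (tateRep W p) ⊤}
    (hx : ∀ k : ℕ,
      (ofTopSubgroup (W.torsionGaloisModule ((p : ℤ) ^ k)).toTopRep 1).hom (reduceH1Pk W p k ⊤ x) =
        kummerMapTorsion W ((p : ℤ) ^ k) (hdiv k) P)
    (hbad : ∀ v ∈ W.badPlaces (𝓞 ℚ), ((Rat.HeightOneSpectrum.primesEquiv v : Nat.Primes) : ℕ) ≠ p →
      ∀ 𝔓 ∈ v.primesAbove,
        resLe (tateRep W p).toTopRep
          (inf_le_left : (⊤ : Subgroup (absoluteGaloisGroup ℚ)) ⊓ 𝔓.inertia (absoluteGaloisGroup ℚ) ≤ ⊤) 1 x = 0) :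
    x ∈ integralH1 (tateRep W p) p ⊤ := by
  rw [mem_integralH1_iff]
  intro v hvp 𝔓 h𝔓
  by_cases hv : v ∈ W.badPlaces (𝓞 ℚ)
  · exact hbad v hv hvp 𝔓 h𝔓
  · exact resLe_inf_inertia_eq_zero_of_forall_eq W p hdiv hx hv hvp h𝔓

/-- **`κ_∞(P) ∈ H¹(ℤ[1/p], T_pW)` when every bad place has residue characteristic `p`** (e.g. the conductor is a power
of `p`): then the hypothesis of `mem_integralH1_of_forall_eq_of_forall_badPlaces` is vacuous.
[cite: Kato2004Asterisque, §8.2 (pp. 180–181) and §14.1 (p. 235)] -/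
theorem mem_integralH1_of_forall_eq_of_badPlaces_subset
    (hdiv : ∀ (k : ℕ) (P : geomPoints W), ∃ Q : geomPoints W, ((p : ℤ) ^ k) • Q = P) {P : W.toAffine.Point}
    {x : H1 (tateRep W p) ⊤}
    (hx : ∀ k : ℕ,
      (ofTopSubgroup (W.torsionGaloisModule ((p : ℤ) ^ k)).toTopRep 1).hom (reduceH1Pk W p k ⊤ x) =
        kummerMapTorsion W ((p : ℤ) ^ k) (hdiv k) P)
    (hbad : ∀ v ∈ W.badPlaces (𝓞 ℚ), ((Rat.HeightOneSpectrum.primesEquiv v : Nat.Primes) : ℕ) = p) :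
    x ∈ integralH1 (tateRep W p) p ⊤ :=
  mem_integralH1_of_forall_eq_of_forall_badPlaces W p hdiv hx fun v hv hvp ↦ absurd (hbad v hv) hvp

end Good

end Summit.BirchSwinnertonDyer.Rank1Residual.Additive.GlobalKummer

end
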